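import Summits.AtomisticToContinuum.Crystallization.Theorems.ChargedEnergyGapChartDialW

/-!
# `ChargedEnergyGap` · the CHART DIAL, part ZE: THE LOWER T-CORNER BOUND AT 1 %
(decomp-a2c lens-3 g39 node «ChargeFreeGap»; second input of the [A] plan — the corner WINDOW
`[arccos (81/200), arccos (1/4)]` that the tree's antiprism budget `Literature…AntiprismShell.no_config` asks for)

`le_tCorner_core`: for a bonded triangle `v a b` of a scale-free configuration (hypotheses = those of part T's
`tCorner_le`: (R1) radii in `[1, 1·01]`, (R2) and (R4)-against-radius for the three bonds) the corner at the spoke `0v`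
satisfies `arccos (81/200) ≤ ∠(perpTo v a, perpTo v b)` (`≈ 66·11°`; numerically the corner is `≥ 69·4°`).

Proof.  Part T's set-up verbatim (normalised cosines `x, y, z ∈ [Z, X]`, `Z = 9799/20000`, `X = 5201/10201`, and
`⟪perpTo v a, perpTo v b⟫ = ‖a‖‖b‖(z − x y)`, `‖perpTo v a‖² = ‖a‖²(1 − x²)`), then the DECOUPLED one-box
certificate `40000 (X − Z²)² ≤ 6561 (1 − X²)²` (`2911·7 ≤ 3593·3`, `norm_num`): `cos ∠ ≤ (X − Z²)/(1 − X²) < 81/200`.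
Corollaries over a scale-free dozen: `IsScaleFreeDozen.le_tCorner` and the weakening of part W's `tCorner` to
`∠ ≤ arccos (1/4)` (`IsScaleFreeDozen.tCorner_le_quarter`) — together exactly `no_config`'s corner window.

No `sorry`, no new axiom, no instance / notation / option; no new definitions.
-/

noncomputable section

open scoped RealInnerProductSpace
open Literature.MathematicalPhysics.StatisticalMechanics
open Literature.Geometry.DiscreteGeometry
open Literature.Geometry.DiscreteGeometry.ShellCensus
open Summit.AtomisticToContinuum.Crystallization.Theses.PricedLinkCensus
open Summit.AtomisticToContinuum.Crystallization.Theorems.ChargedEnergyGapNegative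

namespace Summit.AtomisticToContinuum.Crystallization.Theorems.ChargedEnergyGapChartDial

/-! ## §1 The lower corner bound, core form -/

/-- **The lower T-corner bound at 1 %, core form** (hypotheses verbatim those of part T's `tCorner_le`). -/
theorem le_tCorner_core (v a b : E3) (hv1 : 1 ≤ ‖v‖) (hv2 : ‖v‖ ≤ 101 / 100) (ha1 : 1 ≤ ‖a‖)
    (ha2 : ‖a‖ ≤ 101 / 100) (hb1 : 1 ≤ ‖b‖) (hb2 : ‖b‖ ≤ 101 / 100) (hRva : ‖v‖ ≤ 101 / 100 * dist v a)
    (hRvb : ‖v‖ ≤ 101 / 100 * dist v b) (hRav : ‖a‖ ≤ 101 / 100 * dist v a) (hRab : ‖a‖ ≤ 101 / 100 * dist a b)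
    (hRbv : ‖b‖ ≤ 101 / 100 * dist v b) (hRba : ‖b‖ ≤ 101 / 100 * dist a b) (h4vav : dist v a ≤ 101 / 100 * ‖v‖)
    (h4vaa : dist v a ≤ 101 / 100 * ‖a‖) (h4vbv : dist v b ≤ 101 / 100 * ‖v‖) (h4vbb : dist v b ≤ 101 / 100 * ‖b‖)
    (h4aba : dist a b ≤ 101 / 100 * ‖a‖) (h4abb : dist a b ≤ 101 / 100 * ‖b‖) :
    Real.arccos (81 / 200) ≤ InnerProductGeometry.angle (perpTo v a) (perpTo v b) := by
  -- radii, Gram entries (as in part T)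
  have hrv : 0 < ‖v‖ := by linarith
  have hra : 0 < ‖a‖ := by linarith
  have hrb : 0 < ‖b‖ := by linarith
  have hv0 : v ≠ 0 := norm_pos_iff.1 hrv
  have hvv : ⟪v, v⟫ = ‖v‖ ^ 2 := real_inner_self_eq_norm_sq v
  have haa : ⟪a, a⟫ = ‖a‖ ^ 2 := real_inner_self_eq_norm_sq a
  have hbb : ⟪b, b⟫ = ‖b‖ ^ 2 := real_inner_self_eq_norm_sq b
  have gva : ⟪v, a⟫ = (‖v‖ ^ 2 + ‖a‖ ^ 2 - dist v a ^ 2) / 2 := by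
    rw [dist_eq_norm, norm_sub_sq_real]; ring
  have gvb : ⟪v, b⟫ = (‖v‖ ^ 2 + ‖b‖ ^ 2 - dist v b ^ 2) / 2 := by
    rw [dist_eq_norm, norm_sub_sq_real]; ring
  have gab : ⟪a, b⟫ = (‖a‖ ^ 2 + ‖b‖ ^ 2 - dist a b ^ 2) / 2 := by
    rw [dist_eq_norm, norm_sub_sq_real]; ring
  -- normalised cosines
  obtain ⟨x, hx⟩ : ∃ x : ℝ, ⟪v, a⟫ = x * (‖v‖ * ‖a‖) :=
    ⟨⟪v, a⟫ / (‖v‖ * ‖a‖), (div_mul_cancel₀ _ (mul_pos hrv hra).ne').symm⟩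
  obtain ⟨y, hy⟩ : ∃ y : ℝ, ⟪v, b⟫ = y * (‖v‖ * ‖b‖) :=
    ⟨⟪v, b⟫ / (‖v‖ * ‖b‖), (div_mul_cancel₀ _ (mul_pos hrv hrb).ne').symm⟩
  obtain ⟨z, hz⟩ : ∃ z : ℝ, ⟪a, b⟫ = z * (‖a‖ * ‖b‖) :=
    ⟨⟪a, b⟫ / (‖a‖ * ‖b‖), (div_mul_cancel₀ _ (mul_pos hra hrb).ne').symm⟩
  -- the projections in terms of `x, y, z`
  have hPaa : ⟪perpTo v a, perpTo v a⟫ = ‖a‖ ^ 2 * (1 - x ^ 2) := by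
    rw [inner_perpTo_self hv0, haa, hx, hvv]
    field_simp
  have hPbb : ⟪perpTo v b, perpTo v b⟫ = ‖b‖ ^ 2 * (1 - y ^ 2) := by
    rw [inner_perpTo_self hv0, hbb, hy, hvv]
    field_simp
  have hPab : ⟪perpTo v a, perpTo v b⟫ = ‖a‖ * ‖b‖ * (z - x * y) := by
    have h : ⟪perpTo v a, perpTo v b⟫ = ⟪a, b⟫ - ⟪v, a⟫ / ⟪v, v⟫ * ⟪v, b⟫ := by
      conv_lhs => rw [perpTo_def v b]
      rw [inner_sub_right, real_inner_smul_right, inner_perpTo_left, mul_zero, sub_zero,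
        perpTo_def, inner_sub_left, real_inner_smul_left]
    rw [h, hz, hx, hy, hvv]
    field_simp
  -- scale-free windows for `x, y, z`
  have hd0 : ∀ p q : E3, 0 ≤ dist p q := fun p q => dist_nonneg
  have hx1 : x ≤ 5201 / 10201 := by
    have h := cos_upper hv1 hv2 ha1 ha2 hRva hRav
    rw [← gva, hx] at h
    exact le_of_mul_le_mul_right h (mul_pos hrv hra)
  have hy1 : y ≤ 5201 / 10201 := by
    have h := cos_upper hv1 hv2 hb1 hb2 hRvb hRbv
    rw [← gvb, hy] at h
    exact le_of_mul_le_mul_right h (mul_pos hrv hrb)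
  have hz1 : z ≤ 5201 / 10201 := by
    have h := cos_upper ha1 ha2 hb1 hb2 hRab hRba
    rw [← gab, hz] at h
    exact le_of_mul_le_mul_right h (mul_pos hra hrb)
  have hx0 : 9799 / 20000 ≤ x := by
    have h := cos_lower hrv.le hra.le (hd0 v a) h4vav h4vaa
    rw [← gva, hx] at h
    exact le_of_mul_le_mul_right h (mul_pos hrv hra)
  have hy0 : 9799 / 20000 ≤ y := by
    have h := cos_lower hrv.le hrb.le (hd0 v b) h4vbv h4vbb
    rw [← gvb, hy] at h
    exact le_of_mul_le_mul_right h (mul_pos hrv hrb)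
  have hz0 : 9799 / 20000 ≤ z := by
    have h := cos_lower hra.le hrb.le (hd0 a b) h4aba h4abb
    rw [← gab, hz] at h
    exact le_of_mul_le_mul_right h (mul_pos hra hrb)
  -- the decoupled one-box certificate: `cos ∠ ≤ (X − Z²)/(1 − X²) < 81/200`
  have hxy : 9799 / 20000 * (9799 / 20000) ≤ x * y := mul_le_mul hx0 hy0 (by norm_num) (by linarith)
  have hpos : 0 < z - x * y := (corner_box hx0 hx1 hy0 hy1 hz0 hz1).1
  have hK1 : z - x * y ≤ 5201 / 10201 - 9799 / 20000 * (9799 / 20000) := by linarith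
  have hxsq : x ^ 2 ≤ (5201 / 10201) ^ 2 := pow_le_pow_left₀ (by linarith) hx1 2
  have hysq : y ^ 2 ≤ (5201 / 10201) ^ 2 := pow_le_pow_left₀ (by linarith) hy1 2
  have hX1 : ((5201 : ℝ) / 10201) ^ 2 < 1 := by norm_num
  have hxlt : x ^ 2 < 1 := lt_of_le_of_lt hxsq hX1
  have hylt : y ^ 2 < 1 := lt_of_le_of_lt hysq hX1
  have hineq : 40000 * (z - x * y) ^ 2 ≤ 6561 * ((1 - x ^ 2) * (1 - y ^ 2)) := by
    have h1 : (z - x * y) ^ 2 ≤ (5201 / 10201 - 9799 / 20000 * (9799 / 20000)) ^ 2 :=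
      pow_le_pow_left₀ hpos.le hK1 2
    have h2 : (1 - (5201 / 10201 : ℝ) ^ 2) * (1 - (5201 / 10201) ^ 2) ≤ (1 - x ^ 2) * (1 - y ^ 2) :=
      mul_le_mul (by linarith) (by linarith) (by norm_num) (by linarith)
    have hc : (40000 : ℝ) * (5201 / 10201 - 9799 / 20000 * (9799 / 20000)) ^ 2 ≤
        6561 * ((1 - (5201 / 10201 : ℝ) ^ 2) * (1 - (5201 / 10201) ^ 2)) := by norm_num
    linarith
  -- conclusion
  have hna : 0 < ‖perpTo v a‖ := by
    refine norm_pos_iff.2 (real_inner_self_pos.1 ?_)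
    rw [hPaa]
    exact mul_pos (pow_pos hra 2) (by linarith)
  have hnb : 0 < ‖perpTo v b‖ := by
    refine norm_pos_iff.2 (real_inner_self_pos.1 ?_)
    rw [hPbb]
    exact mul_pos (pow_pos hrb 2) (by linarith)
  have hKpos : 0 ≤ 200 * ⟪perpTo v a, perpTo v b⟫ := by
    rw [hPab]
    exact mul_nonneg (by norm_num) (mul_nonneg (mul_nonneg hra.le hrb.le) hpos.le)
  have nPa : ‖perpTo v a‖ ^ 2 = ‖a‖ ^ 2 * (1 - x ^ 2) := by
    rw [← real_inner_self_eq_norm_sq (perpTo v a), hPaa]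
  have nPb : ‖perpTo v b‖ ^ 2 = ‖b‖ ^ 2 * (1 - y ^ 2) := by
    rw [← real_inner_self_eq_norm_sq (perpTo v b), hPbb]
  have hsq : (200 * ⟪perpTo v a, perpTo v b⟫) ^ 2 ≤ (81 * (‖perpTo v a‖ * ‖perpTo v b‖)) ^ 2 := by
    have hL : (200 * ⟪perpTo v a, perpTo v b⟫) ^ 2 = 40000 * (‖a‖ ^ 2 * ‖b‖ ^ 2) * (z - x * y) ^ 2 := by
      rw [hPab]; ring
    have hR : (81 * (‖perpTo v a‖ * ‖perpTo v b‖)) ^ 2 =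
        6561 * (‖a‖ ^ 2 * ‖b‖ ^ 2) * ((1 - x ^ 2) * (1 - y ^ 2)) := by
      rw [mul_pow, mul_pow, nPa, nPb]; ring
    rw [hL, hR]
    calc 40000 * (‖a‖ ^ 2 * ‖b‖ ^ 2) * (z - x * y) ^ 2
        = ‖a‖ ^ 2 * ‖b‖ ^ 2 * (40000 * (z - x * y) ^ 2) := by ring
      _ ≤ ‖a‖ ^ 2 * ‖b‖ ^ 2 * (6561 * ((1 - x ^ 2) * (1 - y ^ 2))) :=
          mul_le_mul_of_nonneg_left hineq (by positivity)
      _ = 6561 * (‖a‖ ^ 2 * ‖b‖ ^ 2) * ((1 - x ^ 2) * (1 - y ^ 2)) := by ring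
  have h81 : 200 * ⟪perpTo v a, perpTo v b⟫ ≤ 81 * (‖perpTo v a‖ * ‖perpTo v b‖) :=
    (pow_le_pow_iff_left₀ hKpos (by positivity) two_ne_zero).1 hsq
  unfold InnerProductGeometry.angle
  apply Real.arccos_le_arccos
  rw [div_le_iff₀ (mul_pos hna hnb)]
  linarith

/-! ## §2 Over a scale-free dozen: the corner window of the antiprism budget -/

namespace IsScaleFreeDozen

variable {t : Fin 12 → E3} {b : Fin 12 → Fin 12 → Prop}

/-- **Lower T-corner of a scale-free dozen**: for bonds `v a`, `v c`, `a c`, `arccos (81/200) ≤ ∠`. -/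
theorem le_tCorner (hD : IsScaleFreeDozen t b) {v a c : Fin 12} (hva : b v a) (hvc : b v c) (hac : b a c) :
    Real.arccos (81 / 200) ≤ InnerProductGeometry.angle (perpTo (t v) (t a)) (perpTo (t v) (t c)) :=
  le_tCorner_core (t v) (t a) (t c) (hD.one_le_norm v) (hD.norm_le v) (hD.one_le_norm a) (hD.norm_le a)
    (hD.one_le_norm c) (hD.norm_le c) (hD.norm_le_dist (hD.ne_of_bond hva)) (hD.norm_le_dist (hD.ne_of_bond hvc))
    (hD.norm_le_dist' (hD.ne_of_bond hva)) (hD.norm_le_dist (hD.ne_of_bond hac))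
    (hD.norm_le_dist' (hD.ne_of_bond hvc)) (hD.norm_le_dist' (hD.ne_of_bond hac)) (hD.dist_le_norm hva)
    (hD.dist_le_norm' hva) (hD.dist_le_norm hvc) (hD.dist_le_norm' hvc) (hD.dist_le_norm hac) (hD.dist_le_norm' hac)

/-- **Upper T-corner, weakened to the budget's constant**: `∠ ≤ arccos (1/4)` (part W's `tCorner` gives
`≤ arccos (31/100)`). -/
theorem tCorner_le_quarter (hD : IsScaleFreeDozen t b) {v a c : Fin 12} (hva : b v a) (hvc : b v c)
    (hac : b a c) :
    InnerProductGeometry.angle (perpTo (t v) (t a)) (perpTo (t v) (t c)) ≤ Real.arccos (1 / 4) :=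
  (hD.tCorner hva hvc hac).trans (Real.arccos_le_arccos (by norm_num))

/-- **The corner window of a scale-free dozen** in the shape of `no_config`'s hypotheses `hT*` / `hU*`. -/
theorem tCorner_window (hD : IsScaleFreeDozen t b) {v a c : Fin 12} (hva : b v a) (hvc : b v c) (hac : b a c) :
    Real.arccos (81 / 200) ≤ InnerProductGeometry.angle (perpTo (t v) (t a)) (perpTo (t v) (t c)) ∧
      InnerProductGeometry.angle (perpTo (t v) (t a)) (perpTo (t v) (t c)) ≤ Real.arccos (1 / 4) :=
  ⟨hD.le_tCorner hva hvc hac, hD.tCorner_le_quarter hva hvc hac⟩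

end IsScaleFreeDozen

end Summit.AtomisticToContinuum.Crystallization.Theorems.ChargedEnergyGapChartDial

end
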